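import Literature.NumberTheory.IwasawaTheory.FukudaRelationAlgebra
import Mathlib.Algebra.Module.ZMod
import Mathlib.LinearAlgebra.FiniteDimensional.Lemmas
import Mathlib.RingTheory.Polynomial.Basic
import Mathlib.FieldTheory.Finite.Basic
import HarnessLib

/-!
# The RELATION-MATRIX lemma: a `2 × 2` relation matrix whose DETERMINANT has order `d` at `X = 1` modulo `p`, on TWO generators of a finite
# `ℤ[φ]`-module `M`, forces `#(M/pM) ≤ p^d`

Topic `NumberTheory/IwasawaTheory` (namespace `Literature.NumberTheory.IwasawaTheory.FukudaRelation`, as the one-generator relation lemma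
`FukudaRelationAlgebra` of which this is the sequel).  THEOREM-ONLY file (no definition, no named fact, no instance, no `sorry`), written by the prover seat
`bsd-line-att-p3` g54 (cell `bsd-f1-sign2`, route `AlignedTransportAtTwo`; `--supports` stmt-BirchSwinnertonDyer-22298, closes nothing; BSD is not advanced by
this file).  Algebra brick behind the TWO-GENERATOR RELATION DOOR (`ClassGroupPRankLeOfRelationMatrix`).

THE SETTING (Washington §13.3 read at finite level, non-cyclic case).  `M` a finite abelian group (a layer `A_n` of an Iwasawa module `X` that needs TWO generators,
`dim X/𝔪X = 2`), `φ ∈ End_ℤ(M)` with `φ^{p^t} = 1` (the generator of `Gal(K_n/K)`), `T = φ − 1`, `𝔪M = pM + TM`.  If `#(M/𝔪M) ≤ p²` and `x₁, x₂` are independent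
modulo `𝔪M`, then `M = ℤ[φ]x₁ + ℤ[φ]x₂` (Nakayama); TWO relations `A_{j1}(φ)x₁ + A_{j2}(φ)x₂ ∈ pM` (`j = 1,2`) whose DETERMINANT is `(X−1)^d·u + p·g` with `p ∤ u(1)`
— i.e. `det mod p` has ORDER `d` at `X = 1` — give `#(M/pM) ≤ p^d` (and not merely `p^{2d}`, which is what `(φ−1)^d M ⊆ pM` on two generators would give): over
`𝔽_p`, `M/pM` is a module over the discrete valuation ring `𝔽_p⟦T⟧` on two generators whose relation matrix has determinant `T^d·(unit)`, and the length of
`𝔽_p⟦T⟧²/(rows)` is the `T`-order of the determinant.  We avoid Smith normal form by an induction on `d`: a unit entry eliminates one generator (Schur complement, the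
cyclic case), and if all four entries lie in `(T)` then `d ≥ 2` and `T·(M/pM)` carries the divided matrix, of determinant order `d − 2`, on the generators `Tx₁, Tx₂`.
In `Λ`-terms: `X = Λ²/N` with `det N = F`, `F ∉ pΛ` of Weierstrass degree `d` ⟹ `X/pX ≅ 𝔽_p⟦T⟧/(T^d)` has dimension `d`, so `μ = 0` and `λ ≤ d` once `d < p^n − 1`
(door L10 downstream).

* §1 (over a field `F`, `N` nilpotent): `finrank_le_of_relation_matrix_of_coeff_ne_zero` (a unit entry), ★★ `finrank_le_of_relation_matrix` (**`dim V ≤ d`**).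
* §2 ★★ `card_quotient_smul_le_pow_of_relation_matrix` — `M = ℤ[φ]x₁ + ℤ[φ]x₂`, two relations modulo `pM`, `det = (X−1)^d u + p g`, `p ∤ u(1)` ⟹ **`#(M/pM) ≤ p^d`**
  (reduction `f ↦ (f mod p)(X + 1)` to §1 on the `𝔽_p`-space `M/pM`).
* §3 `forall_exists_aeval_add_aeval_eq_of_forall_dvd` — `#(M/𝔪M) ≤ p²` and `x₁, x₂` independent mod `𝔪M` ⟹ `M = ℤ[φ]x₁ + ℤ[φ]x₂`;
  ★★ `card_quotient_smul_le_pow_of_relation_matrix_of_forall_dvd` (generator-certificate form) and ★★ `…_of_sum_smul_pow` (coefficient-vector form: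
  `∑ f_{jk}(i)•φ^i x_k`, determinant identity in `ℤ[X]`).

HONEST SCOPE: classical commutative algebra (finite level of Washington §13.3 / Lang Ch. 5 §3: the structure of finitely generated `Λ`-modules read through one
`2 × 2` determinant); nothing specific to any summit; no certificate for any field is asserted.  Presearch: the length identity `ℓ(R²/A R²) = v(det A)` over a DVR is
textbook (Lang, *Algebra* XIII §4 / III §7; Northcott, *Finite Free Resolutions* §3 (Fitting ideals)); the finite-level `ℤ[φ]`-packaging is not located in print.

References: [Washington1997] L. Washington, *Introduction to Cyclotomic Fields*, 2nd ed., §13.2 Lemma 13.16 (Nakayama), §13.3 Lemmas 13.15, 13.18, Prop. 13.22–13.23;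
[Lang1990] S. Lang, *Cyclotomic Fields I and II*, Ch. 5 §1–§3 (the local ring `Λ`, Weierstrass degree, modules over `Λ`); [Fukuda1994] T. Fukuda, *Remarks on
ℤ_p-extensions of number fields*, Proc. Japan Acad. 70 A (1994), Thm. 1.
-/

set_option autoImplicit false

noncomputable section

open Polynomial Finset Module

universe u

namespace Literature.NumberTheory.IwasawaTheory.FukudaRelation

/-! ## §1 Over a field: two generators, two relations, `det = X^d · (unit)` ⟹ `dim ≤ d` -/

section Field

variable {F : Type*} [Field F]

/-- `f(N) (N w) = N (f(N) w)`: polynomials in `N` commute with `N`. [folklore] -/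
private theorem aeval_apply_self_apply {V : Type*} [AddCommGroup V] [Module F V] (N : Module.End F V) (f : F[X]) (w : V) :
    aeval N f (N w) = N (aeval N f w) := by
  have hc : Commute N (aeval N f) := by
    have h := (Commute.all (X : F[X]) f).map (aeval N); rwa [aeval_X] at h
  rw [← Module.End.mul_apply, ← hc.eq, Module.End.mul_apply]

/-- `f(N)` and `g(N)` commute (applied form). [folklore] -/
private theorem aeval_apply_aeval_apply {V : Type*} [AddCommGroup V] [Module F V] (N : Module.End F V) (f g : F[X]) (w : V) :
    aeval N f (aeval N g w) = aeval N g (aeval N f w) := by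
  rw [← Module.End.mul_apply, ← Module.End.mul_apply, ← map_mul, ← map_mul, mul_comm]

/-- `f(N) w = f(0)·w + N (f'(N) w)` with `f = f(0) + X·f'`: every `f(N)w` lies in `F·w + N(V)`. [folklore] -/
private theorem aeval_apply_mem_span_sup_range {V : Type*} [AddCommGroup V] [Module F V] (N : Module.End F V) (f : F[X]) (w : V) :
    aeval N f w ∈ (F ∙ w) ⊔ LinearMap.range N := by
  obtain ⟨f', hf'⟩ : X ∣ f - C (f.coeff 0) := X_dvd_iff.mpr (by simp)
  have hf : f = C (f.coeff 0) + X * f' := by rw [← hf']; ring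
  rw [hf, map_add, map_mul, aeval_C, aeval_X, LinearMap.add_apply, Module.End.mul_apply, Module.algebraMap_end_apply]
  exact Submodule.add_mem_sup (Submodule.smul_mem _ _ (Submodule.mem_span_singleton_self w)) (LinearMap.mem_range_self N _)

/-- Polynomials in a restricted endomorphism are the restrictions of the polynomials. [folklore] -/
private theorem coe_aeval_restrict_apply {V : Type*} [AddCommGroup V] [Module F V] (N : Module.End F V) {S : Submodule F V}
    (hS : ∀ x ∈ S, N x ∈ S) (f : F[X]) (x : S) : ((aeval (N.restrict hS) f) x : V) = aeval N f (x : V) := by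
  induction f using Polynomial.induction_on' with
  | add f g hf hg => rw [map_add, map_add, LinearMap.add_apply, LinearMap.add_apply, Submodule.coe_add, hf, hg]
  | monomial n c =>
    rw [aeval_monomial, aeval_monomial, Module.End.mul_apply, Module.End.mul_apply, Module.algebraMap_end_apply,
      Module.algebraMap_end_apply, Submodule.coe_smul, Module.End.pow_restrict n hS, LinearMap.coe_restrict_apply]

/-- A subspace stable under `N` is stable under every polynomial in `N`. [folklore] -/
private theorem aeval_apply_mem_of_forall_apply_mem {V : Type*} [AddCommGroup V] [Module F V] (N : Module.End F V) {S : Submodule F V}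
    (hS : ∀ x ∈ S, N x ∈ S) (f : F[X]) {x : V} (hx : x ∈ S) : aeval N f x ∈ S := by
  have h := (aeval (N.restrict hS) f ⟨x, hx⟩).2
  rwa [coe_aeval_restrict_apply] at h

/-- **Elimination step.**  `V` generated over `F[N]` by `w₁, w₂` (`N` nilpotent) with two relations `A₁₁(N)w₁ + A₁₂(N)w₂ = 0`, `A₂₁(N)w₁ + A₂₂(N)w₂ = 0`
whose determinant is `X^d · w`, `w(0) ≠ 0`; if the entry `A₁₁` is a unit of `F⟦X⟧` (`A₁₁(0) ≠ 0`) then `w₁ ∈ F[N]·w₂`, the Schur complement relation reads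
`N^d w₂ = 0`, and **`dim V ≤ d`** (`V` is spanned by `w₂, Nw₂, …, N^{d−1}w₂`). [folklore]
[cite: Washington1997, §13.2 Lemma 13.16 and §13.3 Prop. 13.22 (proof: a relation of Weierstrass degree `d` on a cyclic module)] -/
theorem finrank_le_of_relation_matrix_of_coeff_ne_zero {V : Type*} [AddCommGroup V] [Module F V] [FiniteDimensional F V]
    (N : Module.End F V) (hN : IsNilpotent N) {w₁ w₂ : V} (hgen : ∀ v : V, ∃ f₁ f₂ : F[X], aeval N f₁ w₁ + aeval N f₂ w₂ = v)
    {A₁₁ A₁₂ A₂₁ A₂₂ w : F[X]} (hw : w.coeff 0 ≠ 0) (hA : A₁₁.coeff 0 ≠ 0) {d : ℕ} (hdet : A₁₁ * A₂₂ - A₁₂ * A₂₁ = X ^ d * w)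
    (h₁ : aeval N A₁₁ w₁ + aeval N A₁₂ w₂ = 0) (h₂ : aeval N A₂₁ w₁ + aeval N A₂₂ w₂ = 0) :
    finrank F V ≤ d := by
  classical
  -- a polynomial with nonzero constant term evaluates to a UNIT at the nilpotent `N`
  have hunit : ∀ g : F[X], g.coeff 0 ≠ 0 → IsUnit (aeval N g) := by
    intro g hg
    obtain ⟨g', hg'⟩ : X ∣ g - C (g.coeff 0) := X_dvd_iff.mpr (by simp)
    have hgeq : g = C (g.coeff 0) + X * g' := by rw [← hg']; ring
    have hc : Commute N (aeval N g') := by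
      have h := (Commute.all (X : F[X]) g').map (aeval N); rwa [aeval_X] at h
    rw [hgeq, map_add, map_mul, aeval_C, aeval_X]
    exact (hc.isNilpotent_mul_right hN).isUnit_add_left_of_commute ((isUnit_iff_ne_zero.mpr hg).map _)
      (Algebra.commute_algebraMap_left _ _).symm
  -- the Schur-complement relation: `det(N) w₂ = 0`, hence `N^d w₂ = 0`
  have hdetN : aeval N (A₁₁ * A₂₂ - A₁₂ * A₂₁) w₂ = 0 := by
    have e1 : aeval N A₁₁ w₁ = -aeval N A₁₂ w₂ := eq_neg_of_add_eq_zero_left h₁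
    have e2 : aeval N A₂₂ w₂ = -aeval N A₂₁ w₁ := eq_neg_of_add_eq_zero_right h₂
    rw [map_sub, map_mul, map_mul, LinearMap.sub_apply, Module.End.mul_apply, Module.End.mul_apply, e2, map_neg,
      ← aeval_apply_aeval_apply N A₂₁ A₁₁, e1, map_neg, neg_neg, aeval_apply_aeval_apply N A₂₁ A₁₂, sub_self]
  have hNd : (N ^ d) w₂ = 0 := by
    have h : aeval N (w * X ^ d) w₂ = 0 := by rw [mul_comm, ← hdet, hdetN]
    rw [map_mul, map_pow, aeval_X, Module.End.mul_apply] at h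
    obtain ⟨U, hU⟩ := hunit w hw
    rw [← hU] at h
    have h' := congrArg (↑U⁻¹ : Module.End F V) h
    rwa [map_zero, ← Module.End.mul_apply, Units.inv_mul, Module.End.one_apply] at h'
  -- `S = span {N^i w₂ : i < d}` is `N`-stable, contains `w₂`, and then `w₁`
  set S : Submodule F V := Submodule.span F (Set.range fun i : Fin d => (N ^ (i : ℕ)) w₂) with hSdef
  have hSN : ∀ x ∈ S, N x ∈ S := by
    intro x hx
    refine Submodule.span_induction ?_ (by simp) (fun a b _ _ ha hb => by rw [map_add]; exact S.add_mem ha hb)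
      (fun c a _ ha => by rw [map_smul]; exact S.smul_mem c ha) hx
    rintro _ ⟨i, rfl⟩
    rw [← Module.End.mul_apply, ← pow_succ']
    by_cases hi : (i : ℕ) + 1 < d
    · exact Submodule.subset_span ⟨⟨(i : ℕ) + 1, hi⟩, rfl⟩
    · have heq : (i : ℕ) + 1 = d := by have := i.2; omega
      rw [heq, hNd]; exact S.zero_mem
  have hw₂ : w₂ ∈ S := by
    rcases Nat.eq_zero_or_pos d with hd | hd
    · subst hd; rw [pow_zero, Module.End.one_apply] at hNd; rw [hNd]; exact S.zero_mem
    · have h : (N ^ ((⟨0, hd⟩ : Fin d) : ℕ)) w₂ = w₂ := by simp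
      rw [← h]; exact Submodule.subset_span ⟨⟨0, hd⟩, rfl⟩
  have hw₁ : w₁ ∈ S := by
    obtain ⟨U, hU⟩ := hunit A₁₁ hA
    have hUS : ∀ x ∈ S, (U : Module.End F V) x ∈ S := fun x hx => by
      rw [hU]; exact aeval_apply_mem_of_forall_apply_mem N hSN A₁₁ hx
    have hUw₁ : (U : Module.End F V) w₁ ∈ S := by
      rw [hU, eq_neg_of_add_eq_zero_left h₁]
      exact S.neg_mem (aeval_apply_mem_of_forall_apply_mem N hSN A₁₂ hw₂)
    -- `U` restricted to `S` is injective, hence surjective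
    have hinj : Function.Injective ((U : Module.End F V).restrict hUS) := by
      intro a b hab
      apply Subtype.ext
      have h := congrArg (fun y : S => (y : V)) hab
      simp only [LinearMap.coe_restrict_apply] at h
      have h' := congrArg (↑U⁻¹ : Module.End F V) h
      rwa [← Module.End.mul_apply, ← Module.End.mul_apply, Units.inv_mul, Module.End.one_apply, Module.End.one_apply] at h'
    obtain ⟨s, hs⟩ := (LinearMap.injective_iff_surjective.mp hinj) ⟨_, hUw₁⟩
    have hs' : (U : Module.End F V) s = (U : Module.End F V) w₁ := by
      have h := congrArg (fun y : S => (y : V)) hs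
      simpa only [LinearMap.coe_restrict_apply] using h
    have hsw : (s : V) = w₁ := by
      have h' := congrArg (↑U⁻¹ : Module.End F V) hs'
      rwa [← Module.End.mul_apply, ← Module.End.mul_apply, Units.inv_mul, Module.End.one_apply, Module.End.one_apply] at h'
    rw [← hsw]; exact s.2
  -- `V = S`, `dim S ≤ d`
  have htop : (⊤ : Submodule F V) ≤ S := by
    intro v _
    obtain ⟨f₁, f₂, rfl⟩ := hgen v
    exact S.add_mem (aeval_apply_mem_of_forall_apply_mem N hSN f₁ hw₁) (aeval_apply_mem_of_forall_apply_mem N hSN f₂ hw₂)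
  rw [← finrank_top, ← eq_top_iff.mpr htop, hSdef]
  exact (finrank_range_le_card _).trans (by simp)

/-- ★★ **THE RELATION-MATRIX LEMMA over a field.**  `V` a finite-dimensional `F`-space, `N` a nilpotent endomorphism, `V = F[N]·w₁ + F[N]·w₂`, and a
`2 × 2` relation matrix `(A_{jk}) ∈ M₂(F[X])`: `A₁₁(N)w₁ + A₁₂(N)w₂ = 0`, `A₂₁(N)w₁ + A₂₂(N)w₂ = 0`, with **`det = X^d · w`, `w(0) ≠ 0`**.  THEN **`dim V ≤ d`**
— the length of `F⟦X⟧²/(rows)` is the `X`-order of the determinant, proved by induction on `d` without Smith form: if some entry is a unit, eliminate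
(`finrank_le_of_relation_matrix_of_coeff_ne_zero`); if all four entries vanish at `0`, then `d ≥ 2`, `V/NV` is spanned by `w₁, w₂`, and `NV` carries the
relation matrix `(A_{jk}/X)` of determinant order `d − 2` on the generators `Nw₁, Nw₂`. [folklore]
[cite: Washington1997, §13.2 Lemma 13.16, §13.3 Prop. 13.22–13.23] [cite: Lang1990, Ch. 5 §2 (Weierstrass degree), §3 (modules over `Λ`)] -/
theorem finrank_le_of_relation_matrix (d : ℕ) :
    ∀ {V : Type u} [AddCommGroup V] [Module F V] [FiniteDimensional F V] (N : Module.End F V), IsNilpotent N →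
    ∀ {w₁ w₂ : V}, (∀ v : V, ∃ f₁ f₂ : F[X], aeval N f₁ w₁ + aeval N f₂ w₂ = v) →
    ∀ {A₁₁ A₁₂ A₂₁ A₂₂ w : F[X]}, w.coeff 0 ≠ 0 → A₁₁ * A₂₂ - A₁₂ * A₂₁ = X ^ d * w →
    aeval N A₁₁ w₁ + aeval N A₁₂ w₂ = 0 → aeval N A₂₁ w₁ + aeval N A₂₂ w₂ = 0 → finrank F V ≤ d := by
  classical
  induction d using Nat.strong_induction_on with
  | _ d ih =>
  intro V _ _ _ N hN w₁ w₂ hgen A₁₁ A₁₂ A₂₁ A₂₂ w hw hdet h₁ h₂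
  have hgen' : ∀ v : V, ∃ f₁ f₂ : F[X], aeval N f₁ w₂ + aeval N f₂ w₁ = v := fun v => by
    obtain ⟨f₁, f₂, h⟩ := hgen v; exact ⟨f₂, f₁, by rw [add_comm]; exact h⟩
  by_cases hsome : A₁₁.coeff 0 ≠ 0 ∨ A₁₂.coeff 0 ≠ 0 ∨ A₂₁.coeff 0 ≠ 0 ∨ A₂₂.coeff 0 ≠ 0
  · -- (a) a unit entry: eliminate
    rcases hsome with h | h | h | h
    · exact finrank_le_of_relation_matrix_of_coeff_ne_zero N hN hgen hw h hdet h₁ h₂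
    · exact finrank_le_of_relation_matrix_of_coeff_ne_zero N hN hgen' (A₁₁ := A₁₂) (A₁₂ := A₁₁) (A₂₁ := A₂₂) (A₂₂ := A₂₁)
        (w := -w) (by rwa [coeff_neg, neg_ne_zero]) h (by linear_combination (-1 : F[X]) * hdet) (by rw [add_comm]; exact h₁)
        (by rw [add_comm]; exact h₂)
    · exact finrank_le_of_relation_matrix_of_coeff_ne_zero N hN hgen (A₁₁ := A₂₁) (A₁₂ := A₂₂) (A₂₁ := A₁₁) (A₂₂ := A₁₂)
        (w := -w) (by rwa [coeff_neg, neg_ne_zero]) h (by linear_combination (-1 : F[X]) * hdet) h₂ h₁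
    · exact finrank_le_of_relation_matrix_of_coeff_ne_zero N hN hgen' (A₁₁ := A₂₂) (A₁₂ := A₂₁) (A₂₁ := A₁₂) (A₂₂ := A₁₁)
        (w := w) hw h (by linear_combination hdet) (by rw [add_comm]; exact h₂) (by rw [add_comm]; exact h₁)
  · -- (b) all four entries are divisible by `X`
    push Not at hsome
    obtain ⟨h11, h12, h21, h22⟩ := hsome
    obtain ⟨B₁₁, hB₁₁⟩ : X ∣ A₁₁ := X_dvd_iff.mpr h11
    obtain ⟨B₁₂, hB₁₂⟩ : X ∣ A₁₂ := X_dvd_iff.mpr h12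
    obtain ⟨B₂₁, hB₂₁⟩ : X ∣ A₂₁ := X_dvd_iff.mpr h21
    obtain ⟨B₂₂, hB₂₂⟩ : X ∣ A₂₂ := X_dvd_iff.mpr h22
    have hdet2 : (X : F[X]) ^ 2 * (B₁₁ * B₂₂ - B₁₂ * B₂₁) = X ^ d * w := by
      rw [← hdet, hB₁₁, hB₁₂, hB₂₁, hB₂₂]; ring
    -- `d ≥ 2`
    obtain ⟨d', rfl⟩ : ∃ d', d = d' + 2 := by
      refine ⟨d - 2, ?_⟩
      by_contra hd
      have hlt : d < 2 := by omega
      have h := congrArg (fun q : F[X] => q.coeff d) hdet2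
      simp only [coeff_X_pow_mul', le_refl, if_true, Nat.sub_self] at h
      rw [if_neg (by omega)] at h
      exact hw h.symm
    have hdet' : B₁₁ * B₂₂ - B₁₂ * B₂₁ = X ^ d' * w := by
      apply mul_left_cancel₀ (pow_ne_zero 2 (X_ne_zero (R := F)))
      rw [hdet2, pow_add]; ring
    -- the submodule `N(V)` with the restricted endomorphism
    set S : Submodule F V := LinearMap.range N with hSdef
    have hSN : ∀ x ∈ S, N x ∈ S := fun x _ => LinearMap.mem_range_self N x
    set N' : Module.End F S := N.restrict hSN with hN'def
    have hN'pow : ∀ (n : ℕ) (x : S), (((N' ^ n) x : S) : V) = (N ^ n) (x : V) := fun n x => by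
      rw [hN'def, Module.End.pow_restrict n hSN, LinearMap.coe_restrict_apply]
    have hN' : IsNilpotent N' := by
      obtain ⟨m, hm⟩ := hN
      refine ⟨m, LinearMap.ext fun x => Subtype.ext ?_⟩
      rw [hN'pow, hm, LinearMap.zero_apply, LinearMap.zero_apply, Submodule.coe_zero]
    -- generators `N w₁`, `N w₂` of `N(V)`
    have hgenS : ∀ v : S, ∃ f₁ f₂ : F[X], aeval N' f₁ ⟨N w₁, LinearMap.mem_range_self N w₁⟩ +
        aeval N' f₂ ⟨N w₂, LinearMap.mem_range_self N w₂⟩ = v := by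
      rintro ⟨y, x, hx⟩
      obtain ⟨f₁, f₂, hx'⟩ := hgen x
      refine ⟨f₁, f₂, Subtype.ext ?_⟩
      rw [Submodule.coe_add, coe_aeval_restrict_apply, coe_aeval_restrict_apply]
      change aeval N f₁ (N w₁) + aeval N f₂ (N w₂) = y
      rw [aeval_apply_self_apply, aeval_apply_self_apply, ← map_add, hx', hx]
    -- the divided relations hold on `N(V)`
    have hrelS : ∀ {P Q P' Q' : F[X]}, P = X * P' → Q = X * Q' → aeval N P w₁ + aeval N Q w₂ = 0 →
        aeval N' P' ⟨N w₁, LinearMap.mem_range_self N w₁⟩ + aeval N' Q' ⟨N w₂, LinearMap.mem_range_self N w₂⟩ = 0 := by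
      intro P Q P' Q' hP hQ h
      apply Subtype.ext
      rw [Submodule.coe_add, coe_aeval_restrict_apply, coe_aeval_restrict_apply, Submodule.coe_zero]
      change aeval N P' (N w₁) + aeval N Q' (N w₂) = 0
      rw [aeval_apply_self_apply, aeval_apply_self_apply, ← map_add, ← h, hP, hQ, map_mul, map_mul, aeval_X, map_add,
        Module.End.mul_apply, Module.End.mul_apply]
    have hS : finrank F S ≤ d' :=
      ih d' (by omega) N' hN' hgenS hw hdet' (hrelS hB₁₁ hB₁₂ h₁) (hrelS hB₂₁ hB₂₂ h₂)
    -- `V = (F w₁ + F w₂) + N(V)`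
    set W : Submodule F V := Submodule.span F (Set.range ![w₁, w₂]) with hWdef
    have hw₁W : w₁ ∈ W := Submodule.subset_span ⟨0, rfl⟩
    have hw₂W : w₂ ∈ W := Submodule.subset_span ⟨1, rfl⟩
    have htop : (⊤ : Submodule F V) ≤ W ⊔ S := by
      intro v _
      obtain ⟨f₁, f₂, rfl⟩ := hgen v
      have hle : ∀ {x : V}, x ∈ W → (F ∙ x) ⊔ LinearMap.range N ≤ W ⊔ S := fun hx =>
        sup_le_sup ((Submodule.span_singleton_le_iff_mem _ _).mpr hx) le_rfl
      exact (W ⊔ S).add_mem (hle hw₁W (aeval_apply_mem_span_sup_range N f₁ w₁)) (hle hw₂W (aeval_apply_mem_span_sup_range N f₂ w₂))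
    have hW : finrank F W ≤ 2 := (finrank_range_le_card _).trans (by simp)
    calc finrank F V = finrank F (⊤ : Submodule F V) := (finrank_top (R := F) (M := V)).symm
      _ = finrank F (W ⊔ S : Submodule F V) := by rw [eq_top_iff.mpr htop]
      _ ≤ finrank F W + finrank F S := Submodule.finrank_add_le_finrank_add_finrank W S
      _ ≤ 2 + d' := add_le_add hW hS
      _ = d' + 2 := add_comm _ _

end Field

/-! ## §2 The finite `ℤ[φ]`-module: two generators, a `2 × 2` relation matrix modulo `p`, `det ≡ (X−1)^d·(unit) (mod p)` ⟹ `#(M/pM) ≤ p^d` -/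

section Module

variable {M : Type*} [AddCommGroup M] {p : ℕ}

open FukudaElementary

/-- ★★ **THE RELATION-MATRIX LEMMA.**  `M` a finite abelian group, `φ ∈ End(M)` with `φ^{p^t} = 1`, **`M = ℤ[φ]x₁ + ℤ[φ]x₂`**, and a `2 × 2` matrix
`(A_{jk}) ∈ M₂(ℤ[X])` with **`A₁₁(φ)x₁ + A₁₂(φ)x₂ ∈ pM`, `A₂₁(φ)x₁ + A₂₂(φ)x₂ ∈ pM`** and **`A₁₁A₂₂ − A₁₂A₂₁ = (X−1)^d·u + p·g`, `p ∤ u(1)`**.  THEN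
**`#(M/pM) ≤ p^d`** (NOT `p^{2d}`): `M/pM` is an `𝔽_p[T]`-module (`T = φ − 1` nilpotent) on two generators whose relation matrix has determinant `T^d·(unit)`, and
`finrank_le_of_relation_matrix`.  In `Λ`-terms: `X = Λ²/(relations)` with `det ∉ pΛ` of Weierstrass degree `d` has `X/pX` of dimension `d`.
[cite: Washington1997, §13.2 Lemma 13.16, §13.3 Prop. 13.22–13.23] [cite: Lang1990, Ch. 5 §2–§3] -/
theorem card_quotient_smul_le_pow_of_relation_matrix [Finite M] [hp : Fact p.Prime] (φ : Module.End ℤ M) {t : ℕ} (hφ : φ ^ p ^ t = 1)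
    {x₁ x₂ : M} (hgen : ∀ y : M, ∃ f₁ f₂ : ℤ[X], aeval φ f₁ x₁ + aeval φ f₂ x₂ = y)
    {A₁₁ A₁₂ A₂₁ A₂₂ u g : ℤ[X]} (hu : ¬ (p : ℤ) ∣ u.eval 1) {d : ℕ}
    (hdet : A₁₁ * A₂₂ - A₁₂ * A₂₁ = (X - 1) ^ d * u + C (p : ℤ) * g)
    (h₁ : aeval φ A₁₁ x₁ + aeval φ A₁₂ x₂ ∈ (⊤ : Submodule ℤ M).map ((p : ℤ) • (1 : Module.End ℤ M)))
    (h₂ : aeval φ A₂₁ x₁ + aeval φ A₂₂ x₂ ∈ (⊤ : Submodule ℤ M).map ((p : ℤ) • (1 : Module.End ℤ M))) :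
    Nat.card (M ⧸ (⊤ : Submodule ℤ M).map ((p : ℤ) • (1 : Module.End ℤ M))) ≤ p ^ d := by
  classical
  set P : Submodule ℤ M := (⊤ : Submodule ℤ M).map ((p : ℤ) • (1 : Module.End ℤ M)) with hP
  have hPmem : ∀ x : M, (p : ℤ) • x ∈ P := fun x => Submodule.mem_map.mpr ⟨x, Submodule.mem_top, rfl⟩
  -- `V = M/pM` as an `𝔽_p`-vector space
  have hV : ∀ v : M ⧸ P, p • v = 0 := by
    intro v
    obtain ⟨x, rfl⟩ := Submodule.mkQ_surjective P v
    rw [← map_nsmul, ← natCast_zsmul, Submodule.mkQ_apply, Submodule.Quotient.mk_eq_zero]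
    exact hPmem x
  haveI : Module (ZMod p) (M ⧸ P) := AddCommGroup.zmodModule hV
  haveI : Finite (M ⧸ P) := Finite.of_surjective _ (Submodule.mkQ_surjective P)
  -- `φ` descends to `ψ`, `N = ψ − 1` is nilpotent
  have hφP : P ≤ P.comap φ := fun x hx => apply_mem_map_top_smul φ hx
  let ψ : Module.End (ZMod p) (M ⧸ P) := (P.mapQ P φ hφP).toAddMonoidHom.toZModLinearMap p
  have hψ : ∀ x : M, ψ (P.mkQ x) = P.mkQ (φ x) := fun x => rfl
  have hψpow : ∀ (k : ℕ) (x : M), (ψ ^ k) (P.mkQ x) = P.mkQ ((φ ^ k) x) := by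
    intro k
    induction k with
    | zero => intro x; rfl
    | succ k ih => intro x; rw [pow_succ, Module.End.mul_apply, hψ, ih, ← Module.End.mul_apply, ← pow_succ]
  set N : Module.End (ZMod p) (M ⧸ P) := ψ - 1 with hN
  have hNmk : ∀ x : M, N (P.mkQ x) = P.mkQ ((φ - 1) x) := fun x => by
    rw [hN, LinearMap.sub_apply, Module.End.one_apply, hψ, LinearMap.sub_apply, Module.End.one_apply, map_sub]
  have hNpow : ∀ (k : ℕ) (x : M), (N ^ k) (P.mkQ x) = P.mkQ (((φ - 1) ^ k) x) := by
    intro k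
    induction k with
    | zero => intro x; rfl
    | succ k ih => intro x; rw [pow_succ, Module.End.mul_apply, hNmk, ih, ← Module.End.mul_apply, ← pow_succ]
  have hNnil : IsNilpotent N := by
    obtain ⟨E, hE⟩ := exists_sub_one_pow_eq_smul_aeval φ hφ
    refine ⟨p ^ t, LinearMap.ext fun v => ?_⟩
    obtain ⟨x, rfl⟩ := Submodule.mkQ_surjective P v
    rw [hNpow, hE, LinearMap.zero_apply, LinearMap.smul_apply, Submodule.mkQ_apply, Submodule.Quotient.mk_eq_zero]
    exact hPmem _
  -- the dictionary `f ↦ f̂ = (f mod p)(X + 1) ∈ 𝔽_p[X]`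
  let hat : ℤ[X] → (ZMod p)[X] := fun f => (f.map (Int.castRingHom (ZMod p))).comp (X + 1)
  have hat_def : ∀ f, hat f = (f.map (Int.castRingHom (ZMod p))).comp (X + 1) := fun _ => rfl
  have hat_aeval : ∀ (f : ℤ[X]) (x : M), aeval N (hat f) (P.mkQ x) = P.mkQ (aeval φ f x) := by
    intro f x
    have hN1 : aeval N (X + 1 : (ZMod p)[X]) = ψ := by rw [map_add, aeval_X, map_one, hN, sub_add_cancel]
    rw [hat_def, aeval_comp, hN1]
    induction f using Polynomial.induction_on' with
    | add f g hf hg => rw [Polynomial.map_add, map_add, LinearMap.add_apply, hf, hg, map_add, LinearMap.add_apply, map_add]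
    | monomial n c =>
      rw [Polynomial.map_monomial, aeval_monomial, aeval_monomial, Module.End.mul_apply, Module.End.mul_apply,
        Module.algebraMap_end_apply, Module.algebraMap_end_apply, hψpow, eq_intCast, Int.cast_smul_eq_zsmul, ← map_zsmul]
  -- the data over `𝔽_p`
  have hgenV : ∀ v : M ⧸ P, ∃ f₁ f₂ : (ZMod p)[X], aeval N f₁ (P.mkQ x₁) + aeval N f₂ (P.mkQ x₂) = v := by
    intro v
    obtain ⟨y, rfl⟩ := Submodule.mkQ_surjective P v
    obtain ⟨f₁, f₂, rfl⟩ := hgen y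
    exact ⟨hat f₁, hat f₂, by rw [hat_aeval, hat_aeval, ← map_add]⟩
  have hrelV : ∀ {A B : ℤ[X]}, aeval φ A x₁ + aeval φ B x₂ ∈ P → aeval N (hat A) (P.mkQ x₁) + aeval N (hat B) (P.mkQ x₂) = 0 := by
    intro A B h
    rw [hat_aeval, hat_aeval, ← map_add, Submodule.mkQ_apply, Submodule.Quotient.mk_eq_zero]
    exact h
  have hdetV : hat A₁₁ * hat A₂₂ - hat A₁₂ * hat A₂₁ = X ^ d * hat u := by
    have h := congrArg hat hdet
    simp only [hat_def, Polynomial.map_mul, Polynomial.map_sub, Polynomial.map_add, Polynomial.map_pow, Polynomial.map_X,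
      Polynomial.map_one, Polynomial.map_C, mul_comp, sub_comp, add_comp, pow_comp, X_comp, one_comp, C_comp] at h
    rw [h, eq_intCast, Int.cast_natCast, ZMod.natCast_self, map_zero, zero_mul, add_zero, add_sub_cancel_right]
  have huV : (hat u).coeff 0 ≠ 0 := by
    rw [coeff_zero_eq_eval_zero, hat_def, eval_comp, eval_add, eval_X, eval_one, zero_add, eval_map, eval₂_at_one,
      eq_intCast, ne_eq, ZMod.intCast_zmod_eq_zero_iff_dvd]
    exact_mod_cast hu
  have hfin : finrank (ZMod p) (M ⧸ P) ≤ d :=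
    finrank_le_of_relation_matrix d N hNnil hgenV huV hdetV (hrelV h₁) (hrelV h₂)
  -- `#(M/pM) = p^{dim}`
  letI : Fintype (M ⧸ P) := Fintype.ofFinite _
  have hcard : Nat.card (M ⧸ P) = p ^ finrank (ZMod p) (M ⧸ P) := by
    rw [Nat.card_eq_fintype_card, Module.card_eq_pow_finrank (K := ZMod p) (V := M ⧸ P), ZMod.card]
  rw [hcard]
  exact Nat.pow_le_pow_right hp.out.pos hfin

/-! ## §3 Two generators from two elements independent modulo `𝔪M`, when `#(M/𝔪M) ≤ p²` -/

/-- **`M = ℤ[φ]x₁ + ℤ[φ]x₂`** when `#(M/𝔪M) ≤ p²` (`𝔪M = pM + (φ−1)M`) and `x₁, x₂` are INDEPENDENT modulo `𝔪M` (`a•x₁ + b•x₂ ∈ 𝔪M ⟹ p ∣ a, b`):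
the `p²` elements `a•x₁ + b•x₂` (`0 ≤ a, b < p`) are distinct modulo `𝔪M`, so they exhaust `M/𝔪M`, `M = ℤx₁ + ℤx₂ + 𝔪M`, and Nakayama over `ℤ[φ]`.
[cite: Washington1997, §13.2 Lemma 13.16 (Nakayama), §13.3 Lemma 13.15] -/
theorem forall_exists_aeval_add_aeval_eq_of_forall_dvd [Finite M] [hp : Fact p.Prime] (hM : ∃ a : ℕ, Nat.card M = p ^ a)
    (φ : Module.End ℤ M) {t : ℕ} (hφ : φ ^ p ^ t = 1)
    (hQ : Nat.card (M ⧸ ((⊤ : Submodule ℤ M).map ((p : ℤ) • (1 : Module.End ℤ M)) ⊔ (⊤ : Submodule ℤ M).map (φ - 1))) ≤ p ^ 2)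
    {x₁ x₂ : M} (hx : ∀ a b : ℤ, a • x₁ + b • x₂ ∈ (⊤ : Submodule ℤ M).map ((p : ℤ) • (1 : Module.End ℤ M)) ⊔ (⊤ : Submodule ℤ M).map (φ - 1) →
      (p : ℤ) ∣ a ∧ (p : ℤ) ∣ b) :
    ∀ y : M, ∃ f₁ f₂ : ℤ[X], aeval φ f₁ x₁ + aeval φ f₂ x₂ = y := by
  classical
  set π : Module.End ℤ M := (p : ℤ) • 1 with hπ
  set T : Module.End ℤ M := φ - 1 with hT
  set Q : Submodule ℤ M := (⊤ : Submodule ℤ M).map π ⊔ (⊤ : Submodule ℤ M).map T with hQdef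
  -- the ranges `ℤ[φ]·xᵢ`
  have hrange : ∀ x : M, ∃ R : Submodule ℤ M, (∀ y, y ∈ R ↔ ∃ f : ℤ[X], aeval φ f x = y) ∧ (∀ y ∈ R, φ y ∈ R) := by
    intro x
    let ev : ℤ[X] →ₗ[ℤ] M := (LinearMap.applyₗ x).comp (aeval φ : ℤ[X] →ₐ[ℤ] Module.End ℤ M).toLinearMap
    have hev : ∀ f, ev f = aeval φ f x := fun f => rfl
    refine ⟨LinearMap.range ev, fun y => ?_, ?_⟩
    · rw [LinearMap.mem_range]
      exact ⟨fun ⟨f, hf⟩ => ⟨f, by rw [← hev]; exact hf⟩, fun ⟨f, hf⟩ => ⟨f, by rw [hev]; exact hf⟩⟩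
    · rintro _ ⟨f, rfl⟩
      refine ⟨X * f, ?_⟩
      rw [hev, hev, map_mul, aeval_X, Module.End.mul_apply]
  obtain ⟨R₁, hR₁, hR₁φ⟩ := hrange x₁
  obtain ⟨R₂, hR₂, hR₂φ⟩ := hrange x₂
  -- `M/Q` is exhausted by the classes of `a•x₁ + b•x₂`, `0 ≤ a, b < p`
  haveI : Finite (M ⧸ Q) := Finite.of_surjective _ (Submodule.mkQ_surjective Q)
  let e : Fin p × Fin p → M ⧸ Q := fun ab => Q.mkQ (((ab.1 : ℕ) : ℤ) • x₁ + ((ab.2 : ℕ) : ℤ) • x₂)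
  have hinj : Function.Injective e := by
    rintro ⟨a, b⟩ ⟨a', b'⟩ h
    change Q.mkQ _ = Q.mkQ _ at h
    have h' : (((a : ℕ) : ℤ) • x₁ + ((b : ℕ) : ℤ) • x₂) - ((((a' : ℕ) : ℤ)) • x₁ + ((b' : ℕ) : ℤ) • x₂) ∈ Q :=
      (Submodule.Quotient.eq Q).mp h
    have hmem : (((a : ℕ) : ℤ) - ((a' : ℕ) : ℤ)) • x₁ + (((b : ℕ) : ℤ) - ((b' : ℕ) : ℤ)) • x₂ ∈ Q := by
      convert h' using 1
      simp only [sub_smul]; abel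
    obtain ⟨ha, hb⟩ := hx _ _ hmem
    have key : ∀ {c c' : Fin p}, (p : ℤ) ∣ ((c : ℕ) : ℤ) - ((c' : ℕ) : ℤ) → c = c' := by
      intro c c' hc
      have h1 : (((c' : ℕ) : ℤ)) % p = ((c : ℕ) : ℤ) % p := Int.modEq_iff_dvd.mpr hc
      rw [Int.emod_eq_of_lt (by positivity) (by exact_mod_cast c'.2), Int.emod_eq_of_lt (by positivity) (by exact_mod_cast c.2)] at h1
      exact Fin.ext (by exact_mod_cast h1.symm)
    rw [key ha, key hb]
  have hsurj : Function.Surjective e := by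
    refine (hinj.bijective_of_nat_card_le ?_).2
    rw [Nat.card_prod, Nat.card_fin, ← pow_two]
    exact hQ
  -- `M = ℤx₁ + ℤx₂ + Q`, then Nakayama
  have htop : (⊤ : Submodule ℤ M) ≤ (R₁ ⊔ R₂) ⊔ ((⊤ : Submodule ℤ M).map π ⊔ (⊤ : Submodule ℤ M).map T) := by
    intro y _
    obtain ⟨⟨a, b⟩, hab⟩ := hsurj (Q.mkQ y)
    have hyQ : y - ((((a : ℕ) : ℤ)) • x₁ + (((b : ℕ) : ℤ)) • x₂) ∈ Q := by
      rw [← Submodule.Quotient.eq, ← Submodule.mkQ_apply, ← Submodule.mkQ_apply]; exact hab.symm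
    have hy : y = ((((a : ℕ) : ℤ)) • x₁ + (((b : ℕ) : ℤ)) • x₂) + (y - ((((a : ℕ) : ℤ)) • x₁ + (((b : ℕ) : ℤ)) • x₂)) := by abel
    rw [hy]
    refine Submodule.add_mem_sup (Submodule.add_mem_sup ((hR₁ _).mpr ⟨C ((a : ℕ) : ℤ), ?_⟩) ((hR₂ _).mpr ⟨C ((b : ℕ) : ℤ), ?_⟩)) hyQ
    · rw [aeval_C, algebraMap_int_eq, eq_intCast, Module.End.intCast_apply]
    · rw [aeval_C, algebraMap_int_eq, eq_intCast, Module.End.intCast_apply]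
  have hR : ∀ y ∈ R₁ ⊔ R₂, φ y ∈ R₁ ⊔ R₂ := by
    intro y hy
    obtain ⟨y₁, hy₁, y₂, hy₂, rfl⟩ := Submodule.mem_sup.mp hy
    rw [map_add]; exact Submodule.add_mem_sup (hR₁φ _ hy₁) (hR₂φ _ hy₂)
  have hMR : (⊤ : Submodule ℤ M) ≤ R₁ ⊔ R₂ := le_of_le_sup_smul_sup_sub_one hM φ hφ (fun _ _ => Submodule.mem_top) hR htop
  intro y
  obtain ⟨y₁, hy₁, y₂, hy₂, hy⟩ := Submodule.mem_sup.mp (hMR (Submodule.mem_top (x := y)))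
  obtain ⟨f₁, rfl⟩ := (hR₁ y₁).mp hy₁
  obtain ⟨f₂, rfl⟩ := (hR₂ y₂).mp hy₂
  exact ⟨f₁, f₂, hy⟩

/-- ★★ **THE RELATION-MATRIX LEMMA, generator-certificate form.**  `M` a finite abelian `p`-group, `φ^{p^t} = 1`, **`#(M/𝔪M) ≤ p²`**, `x₁, x₂` independent
modulo `𝔪M`, a `2 × 2` matrix `(A_{jk})` over `ℤ[X]` with `A_{j1}(φ)x₁ + A_{j2}(φ)x₂ ∈ pM` (`j = 1, 2`) and `A₁₁A₂₂ − A₁₂A₂₁ = (X−1)^d u + p g`, `p ∤ u(1)`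
⟹ **`#(M/pM) ≤ p^d`**. [cite: Washington1997, §13.2 Lemma 13.16, §13.3 Prop. 13.22–13.23] [cite: Lang1990, Ch. 5 §2–§3] -/
theorem card_quotient_smul_le_pow_of_relation_matrix_of_forall_dvd [Finite M] [hp : Fact p.Prime] (hM : ∃ a : ℕ, Nat.card M = p ^ a)
    (φ : Module.End ℤ M) {t : ℕ} (hφ : φ ^ p ^ t = 1)
    (hQ : Nat.card (M ⧸ ((⊤ : Submodule ℤ M).map ((p : ℤ) • (1 : Module.End ℤ M)) ⊔ (⊤ : Submodule ℤ M).map (φ - 1))) ≤ p ^ 2)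
    {x₁ x₂ : M} (hx : ∀ a b : ℤ, a • x₁ + b • x₂ ∈ (⊤ : Submodule ℤ M).map ((p : ℤ) • (1 : Module.End ℤ M)) ⊔ (⊤ : Submodule ℤ M).map (φ - 1) →
      (p : ℤ) ∣ a ∧ (p : ℤ) ∣ b)
    {A₁₁ A₁₂ A₂₁ A₂₂ u g : ℤ[X]} (hu : ¬ (p : ℤ) ∣ u.eval 1) {d : ℕ}
    (hdet : A₁₁ * A₂₂ - A₁₂ * A₂₁ = (X - 1) ^ d * u + C (p : ℤ) * g)
    (h₁ : aeval φ A₁₁ x₁ + aeval φ A₁₂ x₂ ∈ (⊤ : Submodule ℤ M).map ((p : ℤ) • (1 : Module.End ℤ M)))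
    (h₂ : aeval φ A₂₁ x₁ + aeval φ A₂₂ x₂ ∈ (⊤ : Submodule ℤ M).map ((p : ℤ) • (1 : Module.End ℤ M))) :
    Nat.card (M ⧸ (⊤ : Submodule ℤ M).map ((p : ℤ) • (1 : Module.End ℤ M))) ≤ p ^ d :=
  card_quotient_smul_le_pow_of_relation_matrix φ hφ (forall_exists_aeval_add_aeval_eq_of_forall_dvd hM φ hφ hQ hx) hu hdet h₁ h₂

/-- `(∑ f_i X^i)(φ) x = ∑ f_i • φ^i x`: the coefficient-vector form of a polynomial in `φ`. [folklore] -/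
private theorem aeval_sum_C_mul_X_pow_apply (φ : Module.End ℤ M) (f : ℕ → ℤ) (N : ℕ) (x : M) :
    aeval φ (∑ i ∈ range N, C (f i) * X ^ i) x = ∑ i ∈ range N, f i • (φ ^ i) x := by
  rw [map_sum, LinearMap.sum_apply]
  refine Finset.sum_congr rfl fun i _ => ?_
  rw [map_mul, aeval_C, map_pow, aeval_X, algebraMap_int_eq, eq_intCast, Module.End.mul_apply, Module.End.intCast_apply]

/-- ★★ **THE RELATION-MATRIX LEMMA, coefficient form.**  As `card_quotient_smul_le_pow_of_relation_matrix_of_forall_dvd`, with the two relations handed over as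
COEFFICIENT VECTORS: **`∑ f₁₁(i)•φ^i x₁ + ∑ f₁₂(i)•φ^i x₂ = 0`**, **`∑ f₂₁(i)•φ^i x₁ + ∑ f₂₂(i)•φ^i x₂ = 0`**, together with the determinant identity
**`(∑ f₁₁(i)X^i)(∑ f₂₂(i)X^i) − (∑ f₁₂(i)X^i)(∑ f₂₁(i)X^i) = (X−1)^d·u + p·g`** in `ℤ[X]`, `p ∤ u(1)` ⟹ **`#(M/pM) ≤ p^d`**.
[cite: Washington1997, §13.3 Prop. 13.22–13.23] [cite: Lang1990, Ch. 5 §2 (Weierstrass degree)] -/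
theorem card_quotient_smul_le_pow_of_relation_matrix_of_sum_smul_pow [Finite M] [hp : Fact p.Prime] (hM : ∃ a : ℕ, Nat.card M = p ^ a)
    (φ : Module.End ℤ M) {t : ℕ} (hφ : φ ^ p ^ t = 1)
    (hQ : Nat.card (M ⧸ ((⊤ : Submodule ℤ M).map ((p : ℤ) • (1 : Module.End ℤ M)) ⊔ (⊤ : Submodule ℤ M).map (φ - 1))) ≤ p ^ 2)
    {x₁ x₂ : M} (hx : ∀ a b : ℤ, a • x₁ + b • x₂ ∈ (⊤ : Submodule ℤ M).map ((p : ℤ) • (1 : Module.End ℤ M)) ⊔ (⊤ : Submodule ℤ M).map (φ - 1) →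
      (p : ℤ) ∣ a ∧ (p : ℤ) ∣ b)
    {N d : ℕ} {f₁₁ f₁₂ f₂₁ f₂₂ : ℕ → ℤ} {u g : ℤ[X]} (hu : ¬ (p : ℤ) ∣ u.eval 1)
    (hF : (∑ i ∈ range N, C (f₁₁ i) * X ^ i : ℤ[X]) * (∑ i ∈ range N, C (f₂₂ i) * X ^ i) -
        (∑ i ∈ range N, C (f₁₂ i) * X ^ i) * (∑ i ∈ range N, C (f₂₁ i) * X ^ i) = (X - 1) ^ d * u + C (p : ℤ) * g)
    (hrel₁ : ∑ i ∈ range N, f₁₁ i • (φ ^ i) x₁ + ∑ i ∈ range N, f₁₂ i • (φ ^ i) x₂ = 0)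
    (hrel₂ : ∑ i ∈ range N, f₂₁ i • (φ ^ i) x₁ + ∑ i ∈ range N, f₂₂ i • (φ ^ i) x₂ = 0) :
    Nat.card (M ⧸ (⊤ : Submodule ℤ M).map ((p : ℤ) • (1 : Module.End ℤ M))) ≤ p ^ d := by
  refine card_quotient_smul_le_pow_of_relation_matrix_of_forall_dvd hM φ hφ hQ hx hu hF ?_ ?_
  · rw [aeval_sum_C_mul_X_pow_apply, aeval_sum_C_mul_X_pow_apply, hrel₁]; exact Submodule.zero_mem _
  · rw [aeval_sum_C_mul_X_pow_apply, aeval_sum_C_mul_X_pow_apply, hrel₂]; exact Submodule.zero_mem _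

end Module


end Literature.NumberTheory.IwasawaTheory.FukudaRelation

end
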